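import Summits.Ventures.CertifiedManyBodySolver.Theses.M3PrimeEdgeSplit
import Literature.MathematicalPhysics.QuantumLattice.HubbardNNNHoppingWindowCertificateD4
import Literature.MathematicalPhysics.QuantumLattice.HubbardTorusGenericSectorCertificate

/-!
# Line `wardk` for crux `M3PrimeEdgeSplit.LowerEdge_ge_m4o5` (item stmt-Ventures-21721)

SU(2)-Ward × affine-`D₄` window certificates, cut for provers through a GENERIC-SECTOR torus
certificate theorem.  Team lb-sym (symmetry reduction), seat hub-lb-sym-plan-2.

The Lean debt of the symmetry-reduction lens is ONE missing null family: every certificate of record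
(CORE #294, MENU #529, the F3′a members) carries SU(2) Ward equality rows `ω([S^±_tot, X]) = 0`,
while the tree's soundness theorem `energyDensityTT'_ge_of_window_certificate_d4` has no Ward slot
(its charge slot needs operators preserving `szSector (2n) 0`, which `S^±` do not).  This line cuts
the repair into three prover-sized lemmas and one certificate-existence statement:

* `stub_genericSectorTorusCert` — `torus_minEnergyOn_div_ge_of_local_certificate` with the sector
  `szSector (2n) 0` replaced by an arbitrary nonzero `A`- and translation-invariant subspace `K`
  (the abstract layer `Matrix.re_projState_ge_of_local_certificate` is already generic in `K`);
* `stub_wardTorus_of_generic` — instantiate at `K = nParticleSubmodule (2n)` of the `t–t'` torus,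
  charges `S^±_torus` (commute with `hubbardTorusTT'`, preserve `K`), ONE density multiplier on the
  total site density (`N̂` is the scalar `2n` on `K`; spin balance is itself a Ward row
  `n_{0↑} − n_{0↓} = [S⁺, c†_{0↓} c_{0↑}]`), window Ward terms transported by
  `[S^±_torus, Γ X] = Γ [S^±_{Λ'}, X]`;
* `stub_wardTL_of_torus` — thermodynamic limit exactly as `energyDensityTT'_ge_of_window_certificate_d4`;
* `stub_wardCert_m4o5` — a Ward × `D₄` window certificate at `(t,t',U,n) = (1,0,8,7/8)` of value
  `≥ −4/5` EXISTS (the computational crux: record −0.8295699476, +0.0296 open).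

`LowerEdge_ge_m4o5_of` composes them into the crux BY NAME.  No summit statement is proved here.
-/

noncomputable section

namespace Summit.Ventures.CertifiedManyBodySolver.Cruxes.LowerEdge_ge_m4o5.WardK

open Matrix Finset
open Literature.MathematicalPhysics.QuantumLattice
open Literature.MathematicalPhysics.QuantumLattice.HubbardWave0
open Literature.MathematicalPhysics.QuantumLattice.ThermodynamicLimit
open Literature.Probability.LatticeModels
open Literature.MathematicalPhysics.QuantumManyBody.StateRelaxation
open scoped ComplexOrder BigOperators

/-- (As in the tree's torus certificate files.) Torus sites are compared through the linear order. -/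
local instance (priority := high) instDecidableEqFermionTorusWardK {d L : ℕ} :
    DecidableEq (FermionTorus d L) := LinearOrder.toDecidableEq

/-- Operators on the fermionic Fock space of the torus `(ℤ/Lℤ)^d`. -/
abbrev TOp (d L : ℕ) : Type :=
  Matrix (Finset (Orb (FermionTorus d L))) (Finset (Orb (FermionTorus d L))) ℂ

/-- **W1 — generic-sector translation-averaged certificate on the fermionic torus.**  The statement of
`torus_minEnergyOn_div_ge_of_local_certificate` with `szSector (2n) 0` replaced by an arbitrary
subspace `K ≠ ⊥` invariant under `A` and under the translation unitaries and their adjoints. -/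
def GenericSectorTorusCert : Prop :=
  ∀ (d L : ℕ) [NeZero L] (A : TOp d L) (_hA : A.IsHermitian)
    (K : Submodule ℂ (Fock (Orb (FermionTorus d L)))) (_hK : K ≠ ⊥)
    (_hKA : ∀ ψ ∈ K, A *ᵥ ψ ∈ K)
    (_hKT : ∀ v : TorusSite d L, ∀ ψ ∈ K, (fockTranslate v).val *ᵥ ψ ∈ K)
    (_hKT' : ∀ v : TorusSite d L, ∀ ψ ∈ K, (fockTranslate v).valᴴ *ᵥ ψ ∈ K)
    (_hAT : ∀ v : TorusSite d L, (fockTranslate v).val * A = A * (fockTranslate v).val)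
    (X : TOp d L) (_hsum : ∑ v : TorusSite d L, (fockTranslate v).val * X * (fockTranslate v).valᴴ = A)
    (δ' : Type) (dens : Finset δ') (μ ν g : δ' → ℝ) (D G : δ' → TOp d L)
    (_hD : ∀ i ∈ dens, ∑ v : TorusSite d L, (fockTranslate v).val * D i * (fockTranslate v).valᴴ = G i)
    (_hGh : ∀ i ∈ dens, (G i).IsHermitian)
    (_hG : ∀ i ∈ dens, ∀ ψ ∈ K, G i *ᵥ ψ = ((g i : ℝ) : ℂ) • ψ)
    (m : Type) (_ : Fintype m) (_ : DecidableEq m) (Λm : Matrix m m ℂ) (_hΛ : Λm.PosSemidef)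
    (O : m → TOp d L)
    (κ : Type) (s : Finset κ) (Xc : κ → TOp d L)
    (ι : Type) (tt : Finset ι) (Us Y : ι → TOp d L)
    (_hU : ∀ l ∈ tt, Us l * A = A * Us l)
    (_hUK : ∀ l ∈ tt, ∀ ψ ∈ K, Us l *ᵥ ψ ∈ K)
    (_hUK' : ∀ l ∈ tt, ∀ ψ ∈ K, (Us l)ᴴ *ᵥ ψ ∈ K)
    (_hUU : ∀ l ∈ tt, (Us l)ᴴ * Us l = 1)
    (ρ : Type) (r : Finset ρ) (Q Z Z' : ρ → TOp d L) (q : ρ → ℝ)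
    (_hQh : ∀ i ∈ r, (Q i).IsHermitian)
    (_hQ : ∀ i ∈ r, ∀ ψ ∈ K, Q i *ᵥ ψ = ((q i : ℝ) : ℂ) • ψ)
    (γ : Type) (u : Finset γ) (C W : γ → TOp d L)
    (_hC : ∀ j ∈ u, C j * A = A * C j)
    (_hCK : ∀ j ∈ u, ∀ ψ ∈ K, C j *ᵥ ψ ∈ K)
    (_hCK' : ∀ j ∈ u, ∀ ψ ∈ K, (C j)ᴴ *ᵥ ψ ∈ K)
    (δ : Type) (ah : Finset δ) (dc : δ → ℝ) (V : δ → TOp d L)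
    (κ'' : Type) (w : Finset κ'') (a : κ'' → ℂ) (M : κ'' → TOp d L)
    (_hM : ∀ k ∈ w, (M k).IsContraction) (c : ℝ),
    X - (c : ℂ) • (1 : TOp d L) - ∑ i ∈ dens, ((μ i : ℝ) : ℂ) • (D i - ((ν i : ℝ) : ℂ) • (1 : TOp d L)) =
      gramForm Λm O +
        (∑ k ∈ s, (A * Xc k - Xc k * A) +
          ∑ l ∈ tt, (Us l * Y l * (Us l)ᴴ - Y l) +
          ∑ i ∈ r, (Z i * (Q i - ((q i : ℝ) : ℂ) • 1) + (Q i - ((q i : ℝ) : ℂ) • 1) * Z' i) +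
          ∑ j ∈ u, (C j * W j - W j * C j)) +
        (∑ m' ∈ ah, ((dc m' : ℝ) : ℂ) • ((V m')ᴴ - V m') + ∑ k ∈ w, a k • M k) →
    c - ∑ k ∈ w, ‖a k‖ + ∑ i ∈ dens, μ i * (g i / (L : ℝ) ^ d - ν i) ≤
      A.minEnergyOn K / (L : ℝ) ^ d

/-- The SU(2)-Ward × affine-`D₄` window identity in `𝔄_{Λ'}` for the `t–t'` Hubbard interaction at
target density `n`, with ONE multiplier `μ` on the total site density and the two Ward null families
`Σ_r (S⁺_{Λ'} X_r − X_r S⁺_{Λ'})`, `Σ_r (S⁻_{Λ'} X'_r − X'_r S⁻_{Λ'})` added to the null terms of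
`groundEnergy_hubbardTorusTT'_div_ge_of_window_certificate_d4`. -/
def WardD4Identity (t t' U n : ℝ) {Λ Λ' : Finset (Site 2)} (hΛ : Λ ⊆ Λ')
    (h0 : thicken ({0} : Finset (Site 2)) 1 ⊆ Λ') (hz : (0 : Site 2) ∈ Λ') (μ : ℝ)
    {m : Type} [Fintype m] [DecidableEq m] (Λm : Matrix m m ℂ) (O : m → FermionOp Λ')
    {κ : Type} (s : Finset κ) (B : κ → FermionOp Λ)
    {ι : Type} (tt : Finset ι) (γ : ι → DihedralGroup 4) (wv : ι → Site 2)
    (hsh : ∀ l, d4ShiftSet (γ l) (wv l) Λ ⊆ Λ') (Y : ι → FermionOp Λ)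
    {ρ : Type} (u : Finset ρ) (b : ρ → ℂ) (cw : ρ → List (Orb (PolySite Λ') × Bool))
    {θ : Type} (wp : Finset θ) (Xp : θ → FermionOp Λ')
    {θ' : Type} (wm : Finset θ') (Xm : θ' → FermionOp Λ')
    {δ : Type} (ah : Finset δ) (dc : δ → ℝ) (V : δ → FermionOp Λ')
    {κ'' : Type} (w : Finset κ'') (a : κ'' → ℂ) (word : κ'' → List (Orb (PolySite Λ') × Bool))
    (c : ℝ) : Prop :=
  fermionEmbed (PolySite.incl h0) ((hubbardTTPrimeFermionInteraction t t' U).meanEnergyObs 1) -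
      (c : ℂ) • (1 : FermionOp Λ') -
      ((μ : ℝ) : ℂ) • (nAt 0 hz 0 + nAt 0 hz 1 - ((n : ℝ) : ℂ) • (1 : FermionOp Λ')) =
    gramForm Λm O +
      (∑ k ∈ s, ((hubbardTTPrimeFermionInteraction t t' U).localHamiltonian Λ' * fermionEmbed (PolySite.incl hΛ) (B k) -
          fermionEmbed (PolySite.incl hΛ) (B k) * (hubbardTTPrimeFermionInteraction t t' U).localHamiltonian Λ') +
        ∑ l ∈ tt, (fermionEmbed (PolySite.incl (hsh l)) (fermionEmbed (PolySite.d4Emb (γ l) (wv l) Λ) (Y l)) -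
          fermionEmbed (PolySite.incl hΛ) (Y l)) +
        ∑ j ∈ u, b j • ladderWord (cw j) +
        ∑ r ∈ wp, ((spinPlus : FermionOp Λ') * Xp r - Xp r * (spinPlus : FermionOp Λ')) +
        ∑ r ∈ wm, ((spinMinus : FermionOp Λ') * Xm r - Xm r * (spinMinus : FermionOp Λ'))) +
      (∑ m' ∈ ah, ((dc m' : ℝ) : ℂ) • ((V m')ᴴ - V m') + ∑ k ∈ w, a k • ladderWord (word k))

/-- **W2 (target) — Ward × `D₄` window certificate ⇒ energy per site of every large `t–t'` torus**,
read in the FULL `2n`-particle sector (all `S^z`), where `S^±` act. -/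
def WardD4TorusCert : Prop :=
  ∀ (t t' U : ℝ) (L : ℕ) [NeZero L], 3 ≤ L →
  ∀ (nh : ℕ), nh ≤ Fintype.card (FermionTorus 2 L) →
  ∀ (n : ℝ) (Λ Λ' : Finset (Site 2)) (hΛ : Λ ⊆ Λ') (_h8 : thicken Λ 1 ⊆ Λ')
    (h0 : thicken ({0} : Finset (Site 2)) 1 ⊆ Λ') (hz : (0 : Site 2) ∈ Λ')
    (_hInj : Set.InjOn (Torus.proj (d := 2) L) ↑(thicken Λ' 1))
    (μ : ℝ)
    (m : Type) (_ : Fintype m) (_ : DecidableEq m) (Λm : Matrix m m ℂ) (_hΛm : Λm.PosSemidef)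
    (O : m → FermionOp Λ')
    (κ : Type) (s : Finset κ) (B : κ → FermionOp Λ)
    (ι : Type) (tt : Finset ι) (γ : ι → DihedralGroup 4) (wv : ι → Site 2)
    (hsh : ∀ l, d4ShiftSet (γ l) (wv l) Λ ⊆ Λ') (Y : ι → FermionOp Λ)
    (ρ : Type) (u : Finset ρ) (b : ρ → ℂ) (cw : ρ → List (Orb (PolySite Λ') × Bool))
    (_hcw : ∀ j ∈ u, ladderCharge (cw j) ≠ 0 ∨ ladderSpinCharge (cw j) ≠ 0)
    (θ : Type) (wp : Finset θ) (Xp : θ → FermionOp Λ')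
    (θ' : Type) (wm : Finset θ') (Xm : θ' → FermionOp Λ')
    (δ : Type) (ah : Finset δ) (dc : δ → ℝ) (V : δ → FermionOp Λ')
    (κ'' : Type) (w : Finset κ'') (a : κ'' → ℂ) (word : κ'' → List (Orb (PolySite Λ') × Bool))
    (c : ℝ),
    WardD4Identity t t' U n hΛ h0 hz μ Λm O s B tt γ wv hsh Y u b cw wp Xp wm Xm ah dc V w a word c →
    c - ∑ k ∈ w, ‖a k‖ + μ * ((((2 * nh : ℕ) : ℝ)) / (L : ℝ) ^ 2 - n) ≤
      groundEnergy (hubbardTorusTT' L t t' U) (2 * nh) / (L : ℝ) ^ 2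

/-- **W3 (target) — Ward × `D₄` window certificate ⇒ thermodynamic-limit energy density**
`c − Σₖ ‖aₖ‖ ≤ energyDensityTT' t t' U n` (`0 ≤ U`, `0 ≤ n < 2`, `thicken Λ 1 ⊆ Λ'`). With the two
Ward families empty and `μ_↑ = μ_↓` this is `energyDensityTT'_ge_of_window_certificate_d4`. -/
def WardD4WindowSound : Prop :=
  ∀ (t t' U : ℝ), 0 ≤ U → ∀ (n : ℝ), 0 ≤ n → n < 2 →
  ∀ (Λ Λ' : Finset (Site 2)) (hΛ : Λ ⊆ Λ') (_h8 : thicken Λ 1 ⊆ Λ')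
    (h0 : thicken ({0} : Finset (Site 2)) 1 ⊆ Λ') (hz : (0 : Site 2) ∈ Λ')
    (μ : ℝ)
    (m : Type) (_ : Fintype m) (_ : DecidableEq m) (Λm : Matrix m m ℂ) (_hΛm : Λm.PosSemidef)
    (O : m → FermionOp Λ')
    (κ : Type) (s : Finset κ) (B : κ → FermionOp Λ)
    (ι : Type) (tt : Finset ι) (γ : ι → DihedralGroup 4) (wv : ι → Site 2)
    (hsh : ∀ l, d4ShiftSet (γ l) (wv l) Λ ⊆ Λ') (Y : ι → FermionOp Λ)
    (ρ : Type) (u : Finset ρ) (b : ρ → ℂ) (cw : ρ → List (Orb (PolySite Λ') × Bool))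
    (_hcw : ∀ j ∈ u, ladderCharge (cw j) ≠ 0 ∨ ladderSpinCharge (cw j) ≠ 0)
    (θ : Type) (wp : Finset θ) (Xp : θ → FermionOp Λ')
    (θ' : Type) (wm : Finset θ') (Xm : θ' → FermionOp Λ')
    (δ : Type) (ah : Finset δ) (dc : δ → ℝ) (V : δ → FermionOp Λ')
    (κ'' : Type) (w : Finset κ'') (a : κ'' → ℂ) (word : κ'' → List (Orb (PolySite Λ') × Bool))
    (c : ℝ),
    WardD4Identity t t' U n hΛ h0 hz μ Λm O s B tt γ wv hsh Y u b cw wp Xp wm Xm ah dc V w a word c →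
    c - ∑ k ∈ w, ‖a k‖ ≤ energyDensityTT' t t' U n

/-- **W4 (the computational crux) — a Ward × `D₄` window certificate of value `≥ −4/5` exists at
`(t, t', U, n) = (1, 0, 8, 7/8)`**, all index sets finite ordinals (checker-friendly normal form). -/
def WardD4Cert_m4o5 : Prop :=
  ∃ (Λ Λ' : Finset (Site 2)) (hΛ : Λ ⊆ Λ') (_h8 : thicken Λ 1 ⊆ Λ')
    (h0 : thicken ({0} : Finset (Site 2)) 1 ⊆ Λ') (hz : (0 : Site 2) ∈ Λ')
    (μ : ℝ)
    (nm : ℕ) (Λm : Matrix (Fin nm) (Fin nm) ℂ) (_hΛm : Λm.PosSemidef) (O : Fin nm → FermionOp Λ')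
    (ns : ℕ) (B : Fin ns → FermionOp Λ)
    (nt : ℕ) (γ : Fin nt → DihedralGroup 4) (wv : Fin nt → Site 2)
    (hsh : ∀ l, d4ShiftSet (γ l) (wv l) Λ ⊆ Λ') (Y : Fin nt → FermionOp Λ)
    (nu : ℕ) (b : Fin nu → ℂ) (cw : Fin nu → List (Orb (PolySite Λ') × Bool))
    (_hcw : ∀ j ∈ (Finset.univ : Finset (Fin nu)), ladderCharge (cw j) ≠ 0 ∨ ladderSpinCharge (cw j) ≠ 0)
    (np : ℕ) (Xp : Fin np → FermionOp Λ') (nm' : ℕ) (Xm : Fin nm' → FermionOp Λ')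
    (na : ℕ) (dc : Fin na → ℝ) (V : Fin na → FermionOp Λ')
    (nw : ℕ) (a : Fin nw → ℂ) (word : Fin nw → List (Orb (PolySite Λ') × Bool))
    (c : ℝ),
    WardD4Identity 1 0 8 (7 / 8) hΛ h0 hz μ Λm O Finset.univ B Finset.univ γ wv hsh Y Finset.univ b cw
      Finset.univ Xp Finset.univ Xm Finset.univ dc V Finset.univ a word c ∧
    (-4 / 5 : ℝ) ≤ c - ∑ k, ‖a k‖

/-! ### Registered stubs -/

/-- W1: generic-sector torus certificate theorem (refactor of
`torus_minEnergyOn_div_ge_of_local_certificate`; size M). -/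
theorem stub_genericSectorTorusCert : GenericSectorTorusCert :=
  -- W1 CLOSED 2026-08-28: sym-eng-3 landed the generic-sector torus theorem in Literature (p609054,
  -- `HubbardTorusGenericSectorCertificate.lean`, binder list = this statement); closes by term.
  torus_minEnergyOn_div_ge_of_local_certificate_generic

/-- W2: the torus-level Ward theorem from W1 at `K = nParticleSubmodule (2n)` with charges `S^±`
(size M–L). -/
theorem stub_wardTorus_of_generic : GenericSectorTorusCert → WardD4TorusCert := by
  sorry

/-- W3: thermodynamic limit (size S–M; the 30-line pattern of
`energyDensityTT'_ge_of_window_certificate_d4` with `energyDensityTT'_ge_of_eventually_ge_torus`). -/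
theorem stub_wardTL_of_torus : WardD4TorusCert → WardD4WindowSound := by
  sorry

/-- W4: certificate existence at value `−4/5` (size XL, computational; record −0.8295699476). -/
theorem stub_wardCert_m4o5 : WardD4Cert_m4o5 := by
  sorry

/-! ### Composition into the crux (kernel-checked; `sorry` only inside the four stubs) -/

/-- The four stub STATEMENTS give the real-number bound `-4 / 5 ≤ e₀(t=1, t'=0, U=8, n=7/8)` (sorry-free;
conclusion deliberately NOT the crux decl, so that the skeleton theorem below is the only decl concluding it). -/
theorem energyDensity_ge_of_stubs :
    GenericSectorTorusCert →
    (GenericSectorTorusCert → WardD4TorusCert) →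
    (WardD4TorusCert → WardD4WindowSound) →
    WardD4Cert_m4o5 →
    (-4 / 5 : ℝ) ≤ energyDensityTT' 1 0 8 (7 / 8) := by
  intro h1 h2 h3 h4
  have hS : WardD4WindowSound := h3 (h2 h1)
  obtain ⟨Λ, Λ', hΛ, h8, h0, hz, μ, nm, Λm, hΛm, O, ns, B, nt, γ, wv, hsh, Y, nu, b, cw, hcw,
    np, Xp, nm', Xm, na, dc, V, nw, a, word, c, hcert, hval⟩ := h4
  have hb := hS 1 0 8 (by norm_num) (7 / 8) (by norm_num) (by norm_num) Λ Λ' hΛ h8 h0 hz μ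
    (Fin nm) inferInstance inferInstance Λm hΛm O (Fin ns) Finset.univ B (Fin nt) Finset.univ γ wv hsh Y
    (Fin nu) Finset.univ b cw hcw (Fin np) Finset.univ Xp (Fin nm') Finset.univ Xm
    (Fin na) Finset.univ dc V (Fin nw) Finset.univ a word c hcert
  linarith

/-- **THE SKELETON THEOREM.** The crux `Summit.Ventures.CertifiedManyBodySolver.Theses.M3PrimeEdgeSplit.LowerEdge_ge_m4o5`
concluded BY NAME from the four declared stubs: W4's certificate read through W3 (W2 (W1)). -/
theorem LowerEdge_ge_m4o5_of : Summit.Ventures.CertifiedManyBodySolver.Theses.M3PrimeEdgeSplit.LowerEdge_ge_m4o5 := by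
  have hb := energyDensity_ge_of_stubs stub_genericSectorTorusCert stub_wardTorus_of_generic
    stub_wardTL_of_torus stub_wardCert_m4o5
  show Summit.Ventures.CertifiedManyBodySolver.MbsolverRungLeaves.M3Lower_tp0_ge_m4o5
  refine ⟨-4 / 5, le_rfl, ?_⟩
  show (((-4 / 5 : ℚ) : ℝ)) ≤ energyDensityTT' 1 0 8 (7 / 8)
  push_cast
  linarith

end Summit.Ventures.CertifiedManyBodySolver.Cruxes.LowerEdge_ge_m4o5.WardK

end
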